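import Mathlib
import Summits.Ventures.PercRepro2.TwoHullMasterGlue2
import Summits.Ventures.PercRepro2.SwGlue

/-!
# Side involutions survive a pendant graph at a vertex other than `l`, `h` (blind cell PercRepro2,
night-4 g39, 2026-08-29; proofs/NIGHT4-G39.md §7, Theorem 5)

Let `(G₁; l, h)` carry a side involution `τ` (TwoHullMasterGlue2.lean) whose hull of `l` and hull
of `h` are disjoint on `U` and whose core of `l` is `{l}` (both hold on a path: the prefix and the
suffix runs are separated by the first mismatch), and glue an ARBITRARY graph `G₂` at a vertex
`c ∈ V₁ ∖ {l, h}` (`Glue.IsGluing`).  Then `τ` extended by «complement `G₂` exactly when `c` lies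
in the hull of `l`» (`pendantAct`) is a side involution of the glued graph
(**`sideInvolution_pendant`**): the hull pair of `l` of the glued graph is the side pair with the
pendant's pair attached where `c` lies (`hullPair_glue_pend`), the complement at the right moments
mirrors it, the pendant at a vertex of the hull of `h` is never complemented so the pair of `h`
keeps moving in the direction of the colour, and the diamond survives because the pendant never
sits in the blue side of a red first colour (the core is `{l}`).  The two side conditions are
preserved (`pendant_hull_disjoint`, `pendant_core`), so pendant graphs can be attached at every
inner vertex of a path one after the other: (MM) holds on every theta graph of DECORATED paths
(paths with arbitrary graphs hanging at their inner vertices), with arbitrary graphs at `l`, `h`.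
-/

namespace Summit.Ventures.PercRepro2

namespace Glue

open Hull LocRows Path2 Glue2

open scoped Classical

variable {V : Type*} {E₁ E₂ : Type*} {ends₁ : E₁ → Sym2 V} {ends₂ : E₂ → Sym2 V} {c l h : V}
  {V₁ V₂ : Set V}

/-- The pair of a vertex of the first side with the pendant's pair attached where the vertex lies. -/
def pendPair (q₁ : Set V × Set V) (c : V) (q₂ : Set V × Set V) : Set V × Set V :=
  (q₁.1 ∪ {x | c ∈ q₁.1 ∧ x ∈ q₂.1}, q₁.2 ∪ {x | c ∈ q₁.2 ∧ x ∈ q₂.2})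

/-- The swap of an attached pair. -/
lemma pendPair_swap (q₁ : Set V × Set V) (c : V) (q₂ : Set V × Set V) :
    (pendPair q₁ c q₂).swap = pendPair q₁.swap c q₂.swap := rfl

/-- The hull pair of a vertex of the first side in the glued graph. -/
lemma hullPair_glue_pend (hg : IsGluing ends₁ ends₂ c V₁ V₂) {v : V} (hv : v ∈ V₁)
    (ζ : Config (E₁ ⊕ E₂)) :
    hullPair (glue ends₁ ends₂) ζ v =
      pendPair (hullPair ends₁ (ζ ∘ Sum.inl) v) c (hullPair ends₂ (ζ ∘ Sum.inr) c) := by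
  have h1 := cluster_glue_eq hg (ζ := ζ) hv
  have h2 := cluster_glue_eq hg (ζ := blue ζ) hv
  rw [blue_comp_inl, blue_comp_inr] at h2
  simp only [hullPair, pendPair, h1, h2]

/-- The pendant action: act on the first side, complement the pendant exactly when `c` lies in the
hull of `l`. -/
noncomputable def pendantAct (τ : Config E₁ → Config E₁) (ends₁ : E₁ → Sym2 V) (l c : V)
    (ζ : Config (E₁ ⊕ E₂)) : Config (E₁ ⊕ E₂) :=
  pair (τ (ζ ∘ Sum.inl))
    (if c ∈ hull ends₁ (ζ ∘ Sum.inl) l then blue (ζ ∘ Sum.inr) else ζ ∘ Sum.inr)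

/-- The first side of the pendant action. -/
lemma pendantAct_inl (τ : Config E₁ → Config E₁) (ζ : Config (E₁ ⊕ E₂)) :
    pendantAct τ ends₁ l c ζ ∘ Sum.inl = τ (ζ ∘ Sum.inl) := rfl

/-- The second side of the pendant action. -/
lemma pendantAct_inr (τ : Config E₁ → Config E₁) (ζ : Config (E₁ ⊕ E₂)) :
    pendantAct τ ends₁ l c ζ ∘ Sum.inr =
      if c ∈ hull ends₁ (ζ ∘ Sum.inl) l then blue (ζ ∘ Sum.inr) else ζ ∘ Sum.inr := rfl

/-- `h ∉ H_l` in the glued graph iff on the first side (`h ∈ V₁ ∖ {c}`). -/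
lemma notMem_hull_glue_iff (hg : IsGluing ends₁ ends₂ c V₁ V₂) (hl : l ∈ V₁) (hh : h ∈ V₁)
    (hhc : h ≠ c) (ζ : Config (E₁ ⊕ E₂)) :
    h ∉ hull (glue ends₁ ends₂) ζ l ↔ h ∉ hull ends₁ (ζ ∘ Sum.inl) l := by
  simp only [mem_hull_iff, mem_cluster_glue_iff₁ hg hl hh hhc, blue_comp_inl]

/-- The hull of `l` is invariant under a side involution (as a set). -/
lemma mem_hull_of_sideInvolution {τ : Config E₁ → Config E₁} {cl : Config E₁ → Bool}
    (h₁ : SideInvolution ends₁ l h τ cl) {ζ : Config E₁} (hU : h ∉ hull ends₁ ζ l) (x : V) :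
    x ∈ hull ends₁ (τ ζ) l ↔ x ∈ hull ends₁ ζ l := by
  have e := h₁.l_mirror ζ hU
  simp only [hullPair, Prod.ext_iff, Prod.swap] at e
  simp only [mem_hull_iff, e.1, e.2]
  tauto

/-- **Pendant compatibility** of a side involution: when the colour is `true`, the red cluster of
`h` avoids the hull of `l` and the blue cluster of `h` AFTER the involution avoids the hull of `l`
(and symmetrically when the colour is `false`); the core of `l` is `{l}`. -/
structure PendantOK (ends : E₁ → Sym2 V) (l h : V) (τ : Config E₁ → Config E₁)
    (cl : Config E₁ → Bool) : Prop where
  red_avoid : ∀ ζ, h ∉ hull ends ζ l → cl ζ = true → ∀ x, x ∈ hull ends ζ l →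
    x ∉ cluster ends ζ h
  blue_avoid' : ∀ ζ, h ∉ hull ends ζ l → cl ζ = true → ∀ x, x ∈ hull ends ζ l →
    x ∉ cluster ends (blue (τ ζ)) h
  blue_avoid : ∀ ζ, h ∉ hull ends ζ l → cl ζ = false → ∀ x, x ∈ hull ends ζ l →
    x ∉ cluster ends (blue ζ) h
  red_avoid' : ∀ ζ, h ∉ hull ends ζ l → cl ζ = false → ∀ x, x ∈ hull ends ζ l →
    x ∉ cluster ends (τ ζ) h
  core : ∀ ζ, h ∉ hull ends ζ l → ∀ x, x ∈ cluster ends ζ l → x ∈ cluster ends (blue ζ) l → x = l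

section Theorem

variable {τ : Config E₁ → Config E₁} {cl : Config E₁ → Bool}
  (hg : IsGluing ends₁ ends₂ c V₁ V₂) (hl : l ∈ V₁) (hh : h ∈ V₁) (hcl : c ≠ l) (hch : c ≠ h)
  (h₁ : SideInvolution ends₁ l h τ cl) (hok : PendantOK ends₁ l h τ cl)
include hg hl hh hcl hch h₁ hok

/-- **A pendant graph at `c ∉ {l, h}` keeps the side involution.** -/
theorem sideInvolution_pendant :
    SideInvolution (glue ends₁ ends₂) l h (pendantAct τ ends₁ l c) (fun ζ => cl (ζ ∘ Sum.inl)) where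
  mem ζ hU := by
    rw [notMem_hull_glue_iff hg hl hh hch.symm] at hU ⊢
    rw [pendantAct_inl]
    exact h₁.mem _ hU
  invol ζ hU := by
    rw [notMem_hull_glue_iff hg hl hh hch.symm] at hU
    have hinv := h₁.invol _ hU
    have hmem := mem_hull_of_sideInvolution h₁ hU c
    simp only [pendantAct, pair_inl, pair_inr, hinv, hmem]
    split_ifs with hc
    · rw [blue_blue, pair_comp]
    · rw [pair_comp]
  l_mirror ζ hU := by
    rw [notMem_hull_glue_iff hg hl hh hch.symm] at hU
    rw [hullPair_glue_pend hg hl, hullPair_glue_pend hg hl, pendantAct_inl, pendantAct_inr,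
      h₁.l_mirror _ hU, pendPair_swap]
    split_ifs with hc
    · rw [hullPair_blue]
    · have hc' : c ∉ (hullPair ends₁ (ζ ∘ Sum.inl) l).1 ∧ c ∉ (hullPair ends₁ (ζ ∘ Sum.inl) l).2 := by
        simp only [mem_hull_iff, not_or, hullPair] at hc ⊢; exact hc
      simp only [pendPair, Prod.swap, hc'.1, hc'.2, false_and, Set.setOf_false, Set.union_empty]
  h_up ζ hU hc := by
    rw [notMem_hull_glue_iff hg hl hh hch.symm] at hU
    have hm := h₁.h_up _ hU hc
    rw [hullPair_glue_pend hg hh, hullPair_glue_pend hg hh, pendantAct_inl, pendantAct_inr]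
    refine ⟨?_, ?_⟩
    · rintro x (hx | ⟨hcT, hx⟩)
      · exact Or.inl (hm.1 hx)
      · have hcH : c ∉ hull ends₁ (ζ ∘ Sum.inl) l := fun hcl' =>
          hok.red_avoid _ hU hc c hcl' hcT
        refine Or.inr ⟨hm.1 hcT, ?_⟩
        simp only [hcH, if_false]; exact hx
    · rintro x (hx | ⟨hcT, hx⟩)
      · exact Or.inl (hm.2 hx)
      · have hcH : c ∉ hull ends₁ (ζ ∘ Sum.inl) l := fun hcl' =>
          hok.blue_avoid' _ hU hc c hcl' hcT
        refine Or.inr ⟨hm.2 hcT, ?_⟩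
        simp only [hcH, if_false] at hx; exact hx
  h_down ζ hU hc := by
    rw [notMem_hull_glue_iff hg hl hh hch.symm] at hU
    have hm := h₁.h_down _ hU hc
    rw [hullPair_glue_pend hg hh, hullPair_glue_pend hg hh, pendantAct_inl, pendantAct_inr]
    refine ⟨?_, ?_⟩
    · rintro x (hx | ⟨hcT, hx⟩)
      · exact Or.inl (hm.1 hx)
      · have hcH : c ∉ hull ends₁ (ζ ∘ Sum.inl) l := fun hcl' =>
          hok.red_avoid' _ hU hc c hcl' hcT
        refine Or.inr ⟨hm.1 hcT, ?_⟩
        simp only [hcH, if_false] at hx; exact hx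
    · rintro x (hx | ⟨hcT, hx⟩)
      · exact Or.inl (hm.2 hx)
      · have hcH : c ∉ hull ends₁ (ζ ∘ Sum.inl) l := fun hcl' =>
          hok.blue_avoid _ hU hc c hcl' hcT
        refine Or.inr ⟨hm.2 hcT, ?_⟩
        simp only [hcH, if_false]; exact hx
  diamond_up ζ hU hc := by
    rw [notMem_hull_glue_iff hg hl hh hch.symm] at hU
    have hd := h₁.diamond_up _ hU hc
    rw [hullPair_glue_pend hg hl]
    have hsub : (pendPair (hullPair ends₁ (ζ ∘ Sum.inl) l) c (hullPair ends₂ (ζ ∘ Sum.inr) c)).2 ⊆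
        (pendPair (hullPair ends₁ (ζ ∘ Sum.inl) l) c (hullPair ends₂ (ζ ∘ Sum.inr) c)).1 := by
      rintro x (hx | ⟨hcB, -⟩)
      · exact Or.inl (hd.1 hx)
      · exfalso
        exact hcl (hok.core _ hU c (hd.1 hcB) hcB)
    exact ⟨hsub, hsub⟩
  diamond_down ζ hU hc := by
    rw [notMem_hull_glue_iff hg hl hh hch.symm] at hU
    have hd := h₁.diamond_down _ hU hc
    rw [hullPair_glue_pend hg hl]
    have hsub : (pendPair (hullPair ends₁ (ζ ∘ Sum.inl) l) c (hullPair ends₂ (ζ ∘ Sum.inr) c)).1 ⊆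
        (pendPair (hullPair ends₁ (ζ ∘ Sum.inl) l) c (hullPair ends₂ (ζ ∘ Sum.inr) c)).2 := by
      rintro x (hx | ⟨hcA, -⟩)
      · exact Or.inl (hd.1 hx)
      · exfalso
        exact hcl (hok.core _ hU c hcA (hd.1 hcA))
    exact ⟨hsub, hsub⟩

end Theorem

/-! ## The compatibility is preserved, and holds on a path -/

/-- Two attached sets meeting force their first parts to meet (at the common point or at `c`). -/
lemma attached_inter {S₁ S₂ P₁ P₂ : Set V} (hS₁ : S₁ ⊆ V₁) (hP₁ : P₁ ⊆ V₁) (hS₂ : S₂ ⊆ V₂)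
    (hP₂ : P₂ ⊆ V₂) (hinter : ∀ x, x ∈ V₁ → x ∈ V₂ → x = c) {x : V}
    (hx : x ∈ S₁ ∪ {y | c ∈ S₁ ∧ y ∈ S₂}) (hx' : x ∈ P₁ ∪ {y | c ∈ P₁ ∧ y ∈ P₂}) :
    ∃ y, y ∈ S₁ ∧ y ∈ P₁ := by
  rcases hx with hx | ⟨hcS, hx⟩ <;> rcases hx' with hx' | ⟨hcP, hx'⟩
  · exact ⟨x, hx, hx'⟩
  · have := hinter x (hS₁ hx) (hP₂ hx'); subst this; exact ⟨x, hx, hcP⟩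
  · have := hinter x (hP₁ hx') (hS₂ hx); subst this; exact ⟨x, hcS, hx'⟩
  · exact ⟨c, hcS, hcP⟩

section Preserve

variable {τ : Config E₁ → Config E₁} {cl : Config E₁ → Bool}
  (hg : IsGluing ends₁ ends₂ c V₁ V₂) (hl : l ∈ V₁) (hh : h ∈ V₁) (hcl : c ≠ l) (hch : c ≠ h)
  (h₁ : SideInvolution ends₁ l h τ cl) (hok : PendantOK ends₁ l h τ cl)
include hg hl hh hcl hch h₁ hok

omit hh hcl hch h₁ hok in
/-- The hull of `l` in the glued graph is a union of two attached sets over the side hull. -/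
lemma hull_glue_subset (ζ : Config (E₁ ⊕ E₂)) {x : V} (hx : x ∈ hull (glue ends₁ ends₂) ζ l) :
    x ∈ cluster ends₁ (ζ ∘ Sum.inl) l ∪
        {y | c ∈ cluster ends₁ (ζ ∘ Sum.inl) l ∧ y ∈ cluster ends₂ (ζ ∘ Sum.inr) c} ∨
      x ∈ cluster ends₁ (blue (ζ ∘ Sum.inl)) l ∪
        {y | c ∈ cluster ends₁ (blue (ζ ∘ Sum.inl)) l ∧ y ∈ cluster ends₂ (blue (ζ ∘ Sum.inr)) c} := by
  rcases hx with hx | hx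
  · left; rw [cluster_glue_eq hg hl] at hx; exact hx
  · right; rw [cluster_glue_eq hg hl, blue_comp_inl, blue_comp_inr] at hx; exact hx

omit hh hcl hch h₁ hok in
/-- A meeting of the hull of `l` with an attached cluster of `h` forces a meeting on the side. -/
lemma side_meet (ζ : Config (E₁ ⊕ E₂)) {x : V} (hx : x ∈ hull (glue ends₁ ends₂) ζ l)
    {P₁ : Set V} {P₂ : Set V} (hP₁ : P₁ ⊆ V₁) (hP₂ : P₂ ⊆ V₂)
    (hx' : x ∈ P₁ ∪ {y | c ∈ P₁ ∧ y ∈ P₂}) :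
    ∃ y, y ∈ hull ends₁ (ζ ∘ Sum.inl) l ∧ y ∈ P₁ := by
  rcases hull_glue_subset hg hl ζ hx with hx | hx
  · obtain ⟨y, hy, hy'⟩ := attached_inter (cluster_subset_of_mem hg hl) hP₁
      (cluster_subset_of_mem₂ hg hg.c_mem₂) hP₂ hg.inter hx hx'
    exact ⟨y, Or.inl hy, hy'⟩
  · obtain ⟨y, hy, hy'⟩ := attached_inter (cluster_subset_of_mem hg hl) hP₁
      (cluster_subset_of_mem₂ hg hg.c_mem₂) hP₂ hg.inter hx hx'
    exact ⟨y, Or.inr hy, hy'⟩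

omit h₁ in
/-- **The compatibility survives the pendant.** -/
theorem pendantOK_pendant :
    PendantOK (glue ends₁ ends₂) l h (pendantAct τ ends₁ l c) (fun ζ => cl (ζ ∘ Sum.inl)) where
  red_avoid ζ hU hc x hx hx' := by
    rw [notMem_hull_glue_iff hg hl hh hch.symm] at hU
    rw [cluster_glue_eq hg hh] at hx'
    obtain ⟨y, hy, hy'⟩ := side_meet hg hl ζ hx (cluster_subset_of_mem hg hh)
      (cluster_subset_of_mem₂ hg hg.c_mem₂) hx'
    exact hok.red_avoid _ hU hc y hy hy'
  blue_avoid' ζ hU hc x hx hx' := by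
    rw [notMem_hull_glue_iff hg hl hh hch.symm] at hU
    rw [cluster_glue_eq hg hh, blue_comp_inl, blue_comp_inr, pendantAct_inl] at hx'
    obtain ⟨y, hy, hy'⟩ := side_meet hg hl ζ hx (cluster_subset_of_mem hg hh)
      (cluster_subset_of_mem₂ hg hg.c_mem₂) hx'
    exact hok.blue_avoid' _ hU hc y hy hy'
  blue_avoid ζ hU hc x hx hx' := by
    rw [notMem_hull_glue_iff hg hl hh hch.symm] at hU
    rw [cluster_glue_eq hg hh, blue_comp_inl, blue_comp_inr] at hx'
    obtain ⟨y, hy, hy'⟩ := side_meet hg hl ζ hx (cluster_subset_of_mem hg hh)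
      (cluster_subset_of_mem₂ hg hg.c_mem₂) hx'
    exact hok.blue_avoid _ hU hc y hy hy'
  red_avoid' ζ hU hc x hx hx' := by
    rw [notMem_hull_glue_iff hg hl hh hch.symm] at hU
    rw [cluster_glue_eq hg hh, pendantAct_inl] at hx'
    obtain ⟨y, hy, hy'⟩ := side_meet hg hl ζ hx (cluster_subset_of_mem hg hh)
      (cluster_subset_of_mem₂ hg hg.c_mem₂) hx'
    exact hok.red_avoid' _ hU hc y hy hy'
  core ζ hU x hx hx' := by
    rw [notMem_hull_glue_iff hg hl hh hch.symm] at hU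
    rw [cluster_glue_eq hg hl] at hx
    rw [cluster_glue_eq hg hl, blue_comp_inl, blue_comp_inr] at hx'
    rcases hx with hx | ⟨hcA, hx⟩ <;> rcases hx' with hx' | ⟨hcB, hx'⟩
    · exact hok.core _ hU x hx hx'
    · have := hg.inter x (cluster_subset_of_mem hg hl hx) (cluster_subset_of_mem₂ hg hg.c_mem₂ hx')
      subst this
      exact absurd (hok.core _ hU x hx hcB) hcl
    · have := hg.inter x (cluster_subset_of_mem hg hl hx') (cluster_subset_of_mem₂ hg hg.c_mem₂ hx)
      subst this
      exact absurd (hok.core _ hU x hcA hx') hcl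
    · exact absurd (hok.core _ hU c hcA hcB) hcl

end Preserve

end Glue

end Summit.Ventures.PercRepro2
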